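import Summits.ABC.StewartYu.PadicG3ExitCPrep
import HarnessLib

/-!
# Cell abc-stewartyu, Gen-3 record (WP-M3.R): clause (C) of the record (the (5.22) cost line) for
# `PadicG3Par`, reduced to a two-parameter constant comparison

`Summits/ABC/StewartYu/PadicG3ExitC.lean` — cell `abc-stewartyu` (HOME `run/shared/lean/pub/abc-stewartyu/`),
route `PadicPrimesKummerThird`, cruxes `Y07Odd` (stmt-ABC-19658) / `Y07Two` (stmt-ABC-19659); seat lp-1 (g2),
record parcel (R3).  Theorems only.

Hypothesis `hCineq` of `RecordAssembly.recordTwo_of_ineqs` / `recordOdd_of_ineqs` for the END parameters of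
`P : PadicG3Par n` (`V := A`, `Vmax := Amax`, `W`, `D₀`, `S₀ := S₀N`, `X := X_fin`, box `Λ := ρ + Amax` of
`PadicG3ExitCPrep.D_mul_A_le`) under the RULED instantiation convention (`K ≤ N_q ≤ 2ⁿK`, `½ ≤ θ₀`,
`Amax ≤ 2ⁿΩ`, `Aⱼ ≥ 1`) and the geometric growth `256^{n−r}·C r ≤ C n` of the admissible constant
(STATUS lp-1 2026-08-27T02:1xZ):

* `Q_mul_le` — for `0 < r < n`, `d₀ ≤ 1`: p4's `Pmax(r,d₀) · (14n+3) ≤ 256^{n−r}·Ω`, GIVEN the two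
  constant comparisons `NC1`/`NC0` (hypotheses `hnum1`, `hnum0`; pure real inequalities in `n, r`, see
  the docstrings) — the chain: `ℓ!·C(S₀+ℓ,ℓ) ≥ (S₀+1)^ℓ`, `(S₀+1)(n+2)⁴ ≥ 16(n+1)L`,
  `2X_fin+1 ≥ 2^{n+22}K·X`, `Λ ≤ λL`, `L ≤ c_L·K·Ω`, `D₀ ≤ X L/2`
  (`λ = 2^{−(n+23)} + 2ⁿ/(24Cbⁿ)`, `c_L = 264Cbⁿ + 2^{2n+26}`, `σ = 16(n+1)/(n+2)⁴`);
* `bracket_le` — `W + log 3 + log n + log Amax + log Q + log 2Q ≤ (14n+3)(W + log 2Amax)` once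
  `Q(14n+3) ≤ 256^{n−r}Ω`, `Ω ≤ Amaxⁿ`;
* `exitC_two`, `exitC_odd` — the `hCineq` hypotheses VERBATIM (the odd one with `+ log p`), from
  `hnum1`/`hnum0` and the growth of `C`.

The numeric hypotheses hold with margin `≥ 2⁵` for all `n ≥ 2`, `1 ≤ r < n` (log-domain check; worst case
`(n,r) = (2,1)`); their kernel proof is the sequel `RecordNumericC.lean`.

WHAT THIS IS NOT: no crux moves; conditional on the explicit numeric hypotheses `hnum1`, `hnum0`.

References: Yu. V. Nesterenko, LNM 1819 (2003), §5.2 (5.19)–(5.22); Prop. 2.6.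
-/

noncomputable section

open Finset Real Nat

namespace Summit.ABC.StewartYu

namespace PadicG3Par

variable {n : ℕ} (P : PadicG3Par n)

/-! ### The bracket of logarithms -/

/-- `Ω ≤ Amaxⁿ` (`0 ≤ Aⱼ ≤ Amax`). [folklore] -/
theorem Ω_le_pow : P.Ω ≤ P.Amax ^ n := by
  unfold Ω
  calc ∏ j, P.A j ≤ ∏ _j : Fin n, P.Amax :=
        prod_le_prod (fun j _ => (P.A_pos j).le) fun j _ => P.hAmax j
    _ = P.Amax ^ n := by rw [prod_const, Finset.card_univ, Fintype.card_fin]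

/-- **The logarithmic bracket.**  If `0 < Q` and `Q·(14n+3) ≤ 256^{n−r}·Ω` (`r < n`), then with
`W ≥ 1`, `Amax ≥ 1`, `Ω ≤ Amaxⁿ` and any `E ≥ 0` (`E = log p` for the odd clause, `0` for `p = 2`):
`W + log 3 + log n + log Amax + log Q + E + log 2Q ≤ (14n+3)·(W + E + log 2Amax)`. [folklore] -/
theorem bracket_le {r : ℕ} {Q E : ℝ} (hQ0 : 0 < Q) (hE : 0 ≤ E)
    (hQ : Q * (14 * n + 3) ≤ (256 : ℝ) ^ (n - r) * P.Ω) :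
    P.W + Real.log 3 + Real.log n + Real.log P.Amax + Real.log Q + E + Real.log (2 * Q) ≤
      (14 * n + 3) * (P.W + E + Real.log (2 * P.Amax)) := by
  have hW := P.hW
  have hA1 := P.hAmax1
  have hΩ := P.Ω_pos
  have hn1 : (1 : ℝ) ≤ n := by exact_mod_cast P.hn
  have hlogA : 0 ≤ Real.log P.Amax := Real.log_nonneg hA1
  have hlog2 : Real.log 2 < 0.6931471808 := Real.log_two_lt_d9
  have hlog2' : 0 < Real.log 2 := by have := Real.log_two_gt_d9; linarith
  have hlog3 : Real.log 3 ≤ 2 := by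
    have := Real.log_le_sub_one_of_pos (show (0 : ℝ) < 3 by norm_num); linarith
  have hlogn : Real.log n ≤ n := by
    have := Real.log_le_sub_one_of_pos (show (0 : ℝ) < n by linarith); linarith
  -- `log Ω ≤ n log Amax`
  have hlogΩ : Real.log P.Ω ≤ n * Real.log P.Amax := by
    have h := Real.log_le_log hΩ P.Ω_le_pow
    rwa [Real.log_pow] at h
  -- `Q ≤ 256^{n-r} Ω` and `log Q ≤ 8 (n-r) log 2 + n log Amax ≤ 5.6 n + n log Amax`
  have hQ1 : Q ≤ (256 : ℝ) ^ (n - r) * P.Ω := by nlinarith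
  have hlogQ : Real.log Q ≤ 5.6 * n + n * Real.log P.Amax := by
    have h := Real.log_le_log hQ0 hQ1
    rw [Real.log_mul (by positivity) hΩ.ne', Real.log_pow] at h
    have h256 : Real.log 256 = 8 * Real.log 2 := by
      rw [show (256 : ℝ) = 2 ^ 8 by norm_num, Real.log_pow]; norm_num
    rw [h256] at h
    have hnr : ((n - r : ℕ) : ℝ) ≤ n := by exact_mod_cast Nat.sub_le n r
    have : ((n - r : ℕ) : ℝ) * (8 * Real.log 2) ≤ n * 5.6 := by nlinarith
    linarith
  have hlog2Q : Real.log (2 * Q) ≤ 0.7 + 5.6 * n + n * Real.log P.Amax := by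
    rw [Real.log_mul (by norm_num) hQ0.ne']; linarith
  have hlog2A : Real.log (2 * P.Amax) = Real.log 2 + Real.log P.Amax := by
    rw [Real.log_mul (by norm_num) (by linarith)]
  rw [hlog2A]
  have hn0 : (0 : ℝ) ≤ n := by linarith
  -- the products with `n`
  have t1 : (n : ℝ) ≤ (n : ℝ) * P.W := by nlinarith
  have t2 : 0 ≤ (n : ℝ) * E := mul_nonneg hn0 hE
  have t3 : 0 ≤ (n : ℝ) * Real.log P.Amax := mul_nonneg hn0 hlogA
  have t4 : 0 ≤ (n : ℝ) * Real.log 2 := mul_nonneg hn0 hlog2'.le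
  have e : (14 * (n : ℝ) + 3) * (P.W + E + (Real.log 2 + Real.log P.Amax)) =
      14 * ((n : ℝ) * P.W) + 3 * P.W + 14 * ((n : ℝ) * E) + 3 * E + 14 * ((n : ℝ) * Real.log 2) +
        3 * Real.log 2 + 14 * ((n : ℝ) * Real.log P.Amax) + 3 * Real.log P.Amax := by ring
  rw [e]
  linarith

/-! ### `Q·(14n+3) ≤ 256^{n−r}·Ω` from the constant comparisons -/

/-- The END denominators are positive. [folklore] -/
theorem den_pos (r d₀ : ℕ) :
    (0 : ℝ) < ((Nat.choose (P.S₀N + (r - d₀)) (r - d₀) * (2 * P.Xfin + 1) *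
      ((d₀ + (n - r))! * 2 ^ (n - r) * P.D₀ ^ d₀) : ℕ) : ℝ) := by
  have h1 : 0 < Nat.choose (P.S₀N + (r - d₀)) (r - d₀) := Nat.choose_pos (Nat.le_add_left _ _)
  have h2 : 0 < (d₀ + (n - r))! := Nat.factorial_pos _
  have h3 : 0 < P.D₀ ^ d₀ := pow_pos (by unfold D₀; omega) _
  positivity

/-- The common magnitudes for clause (C): `s = S₀+1 ≥ σL`, `ℓ!·C(S₀+ℓ,ℓ) ≥ s^ℓ`, `2X_fin+1 ≥ 2^{n+22}K·X`,
`Λ ≤ λL`, `L ≤ c_L K Ω`. [cite: Nesterenko2003, §5.2 (5.21)] -/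
theorem clauseC_facts (hKNq : P.K ≤ P.Nq) (hNqK : P.Nq ≤ 2 ^ n * P.K) (hθ : (1 / 2 : ℝ) ≤ P.θ₀)
    (hAmax : P.Amax ≤ 2 ^ n * P.Ω) (hA1 : ∀ j, 1 ≤ P.A j) :
    (16 * ((n : ℝ) + 1) / ((n : ℝ) + 2) ^ 4) * P.L ≤ (P.S₀N : ℝ) + 1 ∧
    (∀ ℓ : ℕ, ((P.S₀N : ℝ) + 1) ^ ℓ ≤ ((ℓ ! : ℕ) : ℝ) * ((Nat.choose (P.S₀N + ℓ) ℓ : ℕ) : ℝ)) ∧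
    (2 : ℝ) ^ (n + 22) * P.K * P.X ≤ 2 * (P.Xfin : ℝ) + 1 ∧
    (P.Nq : ℝ) * P.L / 2 ^ P.Sdepth + P.Amax ≤ (((2 : ℝ) ^ (n + 23))⁻¹ + 2 ^ n / (24 * Cb ^ n)) * P.L ∧
    (P.L : ℝ) ≤ (264 * Cb ^ n + 2 ^ (2 * n + 26)) * P.K * P.Ω := by
  refine ⟨?_, ?_, ?_, ?_, P.L_le_KΩ hθ hNqK hAmax hA1⟩
  · have hs := P.sixteen_mul_L_lt
    rw [div_mul_eq_mul_div, div_le_iff₀ (by positivity)]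
    nlinarith
  · intro ℓ
    have h := RecordExitsNumeric.pow_le_factorial_mul_choose P.S₀N ℓ
    have : ((((P.S₀N + 1) ^ ℓ : ℕ)) : ℝ) ≤ ((ℓ ! * (P.S₀N + ℓ).choose ℓ : ℕ) : ℝ) := by exact_mod_cast h
    push_cast at this; exact this
  · have h1 : (2 : ℝ) ^ (n + 22) * P.K < 2 ^ (P.Sdepth - 1) := by exact_mod_cast P.two_pow_mul_K_lt hKNq
    have h2 : (2 : ℝ) ^ (P.Sdepth - 1) * P.X ≤ 2 * (P.Xfin : ℝ) := by
      exact_mod_cast P.two_pow_mul_X_le_two_Xfin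
    have hX : (0 : ℝ) ≤ P.X := by positivity
    nlinarith
  · have h := P.rho_add_Amax_le hAmax; linarith

set_option maxHeartbeats 400000 in
/-- **Clause (C) core, `d₀ = 1`**: p4's `Pmax(r,1)·(14n+3) ≤ 256^{n−r}Ω` from the constant comparison
`NC1 r : (r!)²nʳ(n+1)!2ʳ(r−1)!·λʳ·c_L·(14n+3) ≤ 256^{n−r}σ^{r−1}2^{n+22}(n−r+1)!`
(`λ = (2^{n+23})⁻¹ + 2ⁿ/(24Cbⁿ)`, `c_L = 264Cbⁿ + 2^{2n+26}`, `σ = 16(n+1)/(n+2)⁴`).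
[cite: Nesterenko2003, §5.2 (5.21)–(5.22)] -/
theorem Q_mul_le_one (hKNq : P.K ≤ P.Nq) (hNqK : P.Nq ≤ 2 ^ n * P.K) (hθ : (1 / 2 : ℝ) ≤ P.θ₀)
    (hAmax : P.Amax ≤ 2 ^ n * P.Ω) (hA1 : ∀ j, 1 ≤ P.A j) {r : ℕ} (hr0 : 0 < r) (hrn : r < n)
    (hnum : ((r ! : ℕ) : ℝ) ^ 2 * (n : ℝ) ^ r * (((n + 1)! : ℕ) : ℝ) * 2 ^ r * (((r - 1)! : ℕ) : ℝ) *
          (((2 : ℝ) ^ (n + 23))⁻¹ + 2 ^ n / (24 * Cb ^ n)) ^ r * (264 * Cb ^ n + 2 ^ (2 * n + 26)) *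
          (14 * n + 3) ≤
        (256 : ℝ) ^ (n - r) * (16 * ((n : ℝ) + 1) / ((n : ℝ) + 2) ^ 4) ^ (r - 1) * 2 ^ (n + 22) *
          (((n - r + 1)! : ℕ) : ℝ)) :
    ((r ! : ℕ) : ℝ) ^ 2 * (n : ℝ) ^ r *
        (((((n + 1)! * 2 ^ n * P.D₀ : ℕ) : ℝ) * ((P.Nq : ℝ) * P.L / 2 ^ P.Sdepth + P.Amax) ^ r /
          ((Nat.choose (P.S₀N + (r - 1)) (r - 1) * (2 * P.Xfin + 1) *
            ((1 + (n - r))! * 2 ^ (n - r) * P.D₀ ^ 1) : ℕ) : ℝ))) * (14 * n + 3) ≤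
      (256 : ℝ) ^ (n - r) * P.Ω := by
  obtain ⟨hσL, hchoose, hxfK, hΛL, hLKΩ⟩ := P.clauseC_facts hKNq hNqK hθ hAmax hA1
  set lam : ℝ := ((2 : ℝ) ^ (n + 23))⁻¹ + 2 ^ n / (24 * Cb ^ n) with hlam
  set cL : ℝ := 264 * Cb ^ n + 2 ^ (2 * n + 26) with hcL
  set σ : ℝ := 16 * ((n : ℝ) + 1) / ((n : ℝ) + 2) ^ 4 with hσ
  set s : ℝ := (P.S₀N : ℝ) + 1 with hsdef
  set Λ : ℝ := (P.Nq : ℝ) * P.L / 2 ^ P.Sdepth + P.Amax with hΛdef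
  set L : ℝ := (P.L : ℝ) with hLdef
  have hL : 0 < L := by rw [hLdef]; linarith [P.one_le_L]
  have hΩ := P.Ω_pos
  have hKpos := P.K_pos
  have hX1 : (1 : ℝ) ≤ P.X := by exact_mod_cast P.one_le_X
  have hΛ0 : 0 ≤ Λ := by have := P.hAmax1; positivity
  have hCb : (0 : ℝ) < Cb ^ n := by have := sixtyfour_le_Cb; positivity
  have hσ0 : 0 < σ := by positivity
  have hcL0 : 0 < cL := by positivity
  have hΛr : Λ ^ r ≤ (lam * L) ^ r := pow_le_pow_left₀ hΛ0 hΛL r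
  have hch := hchoose (r - 1)
  have hden := P.den_pos r 1
  have e1 : 1 + (n - r) = n - r + 1 := by omega
  simp only [e1, pow_one] at hden ⊢
  rw [mul_div_assoc', div_mul_eq_mul_div, div_le_iff₀ hden]
  push_cast
  have h2n : (2 : ℝ) ^ n = 2 ^ r * 2 ^ (n - r) := by rw [← pow_add, Nat.add_sub_cancel' hrn.le]
  have hLr : L ^ r = L ^ (r - 1) * L := by rw [← pow_succ, Nat.sub_add_cancel hr0]
  have hr1fac : (0 : ℝ) < (((r - 1)! : ℕ) : ℝ) := by exact_mod_cast Nat.factorial_pos _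
  -- the scale factor
  set S : ℝ := L ^ r * 2 ^ (n - r) * (P.D₀ : ℝ) with hS
  have hD₀pos : (0 : ℝ) < P.D₀ := by exact_mod_cast (show 0 < P.D₀ by unfold D₀; omega)
  have hS0 : 0 < S := by rw [hS]; positivity
  -- (1) numerator ≤ (numeric LHS) · S / ((r-1)! cL), written multiplicatively
  have step1 : ((r ! : ℕ) : ℝ) ^ 2 * (n : ℝ) ^ r * ((((n + 1)! : ℕ) : ℝ) * 2 ^ n * (P.D₀ : ℝ) * Λ ^ r) *
        (14 * n + 3) * ((((r - 1)! : ℕ) : ℝ) * cL) ≤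
      (((r ! : ℕ) : ℝ) ^ 2 * (n : ℝ) ^ r * (((n + 1)! : ℕ) : ℝ) * 2 ^ r * (((r - 1)! : ℕ) : ℝ) *
          lam ^ r * cL * (14 * n + 3)) * S := by
    have h1 : ((((n + 1)! : ℕ) : ℝ) * 2 ^ n * (P.D₀ : ℝ) * Λ ^ r) ≤
        (((n + 1)! : ℕ) : ℝ) * 2 ^ n * (P.D₀ : ℝ) * (lam * L) ^ r :=
      mul_le_mul_of_nonneg_left hΛr (by positivity)
    calc ((r ! : ℕ) : ℝ) ^ 2 * (n : ℝ) ^ r * ((((n + 1)! : ℕ) : ℝ) * 2 ^ n * (P.D₀ : ℝ) * Λ ^ r) *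
          (14 * n + 3) * ((((r - 1)! : ℕ) : ℝ) * cL)
        ≤ ((r ! : ℕ) : ℝ) ^ 2 * (n : ℝ) ^ r * ((((n + 1)! : ℕ) : ℝ) * 2 ^ n * (P.D₀ : ℝ) * (lam * L) ^ r) *
          (14 * n + 3) * ((((r - 1)! : ℕ) : ℝ) * cL) := by gcongr
      _ = (((r ! : ℕ) : ℝ) ^ 2 * (n : ℝ) ^ r * (((n + 1)! : ℕ) : ℝ) * 2 ^ r * (((r - 1)! : ℕ) : ℝ) *
          lam ^ r * cL * (14 * n + 3)) * S := by rw [hS, h2n, mul_pow]; ring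
  -- (2) numeric comparison, scaled by `S`
  have step2 : (((r ! : ℕ) : ℝ) ^ 2 * (n : ℝ) ^ r * (((n + 1)! : ℕ) : ℝ) * 2 ^ r * (((r - 1)! : ℕ) : ℝ) *
          lam ^ r * cL * (14 * n + 3)) * S ≤
      ((256 : ℝ) ^ (n - r) * σ ^ (r - 1) * 2 ^ (n + 22) * (((n - r + 1)! : ℕ) : ℝ)) * S :=
    mul_le_mul_of_nonneg_right hnum hS0.le
  -- (3) `σ^{r-1} L^{r-1} ≤ (r-1)! choose`, `L ≤ cL K Ω`, `2^{n+22} K ≤ xf`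
  have hσpow : (σ * L) ^ (r - 1) ≤ (((r - 1)! : ℕ) : ℝ) * ((Nat.choose (P.S₀N + (r - 1)) (r - 1) : ℕ) : ℝ) :=
    (pow_le_pow_left₀ (by positivity) hσL _).trans hch
  have hK1 : (2 : ℝ) ^ (n + 22) * P.K ≤ 2 * (P.Xfin : ℝ) + 1 := by nlinarith
  have step3 : ((256 : ℝ) ^ (n - r) * σ ^ (r - 1) * 2 ^ (n + 22) * (((n - r + 1)! : ℕ) : ℝ)) * S ≤
      (256 : ℝ) ^ (n - r) * P.Ω * (((Nat.choose (P.S₀N + (r - 1)) (r - 1) : ℕ) : ℝ) *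
        (2 * (P.Xfin : ℝ) + 1) * ((((n - r + 1)! : ℕ) : ℝ) * 2 ^ (n - r) * (P.D₀ : ℝ))) *
        ((((r - 1)! : ℕ) : ℝ) * cL) := by
    calc ((256 : ℝ) ^ (n - r) * σ ^ (r - 1) * 2 ^ (n + 22) * (((n - r + 1)! : ℕ) : ℝ)) * S
        = (256 : ℝ) ^ (n - r) * (σ * L) ^ (r - 1) * L * (2 ^ (n + 22)) *
            ((((n - r + 1)! : ℕ) : ℝ) * 2 ^ (n - r) * (P.D₀ : ℝ)) := by rw [hS, hLr, mul_pow]; ring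
      _ ≤ (256 : ℝ) ^ (n - r) * ((((r - 1)! : ℕ) : ℝ) * ((Nat.choose (P.S₀N + (r - 1)) (r - 1) : ℕ) : ℝ)) *
            (cL * P.K * P.Ω) * (2 ^ (n + 22)) * ((((n - r + 1)! : ℕ) : ℝ) * 2 ^ (n - r) * (P.D₀ : ℝ)) := by
          gcongr
      _ = (256 : ℝ) ^ (n - r) * P.Ω * (((Nat.choose (P.S₀N + (r - 1)) (r - 1) : ℕ) : ℝ) *
            (2 ^ (n + 22) * P.K) * ((((n - r + 1)! : ℕ) : ℝ) * 2 ^ (n - r) * (P.D₀ : ℝ))) *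
            ((((r - 1)! : ℕ) : ℝ) * cL) := by ring
      _ ≤ (256 : ℝ) ^ (n - r) * P.Ω * (((Nat.choose (P.S₀N + (r - 1)) (r - 1) : ℕ) : ℝ) *
            (2 * (P.Xfin : ℝ) + 1) * ((((n - r + 1)! : ℕ) : ℝ) * 2 ^ (n - r) * (P.D₀ : ℝ))) *
            ((((r - 1)! : ℕ) : ℝ) * cL) := by gcongr
  exact le_of_mul_le_mul_right (step1.trans (step2.trans step3)) (by positivity)

/-- **Clause (C) core, `d₀ = 0`**: p4's `Pmax(r,0)·(14n+3) ≤ 256^{n−r}Ω` from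
`NC0 r : (r!)³nʳ(n+1)!2^{r−1}·λʳ·c_L·(14n+3) ≤ 256^{n−r}σʳ2^{n+22}(n−r)!`; here `D₀ ≤ X L/2` cancels the
`X` of `2X_fin + 1 ≥ 2^{n+22}K·X`. [cite: Nesterenko2003, §5.2 (5.21)–(5.22)] -/
theorem Q_mul_le_zero (hKNq : P.K ≤ P.Nq) (hNqK : P.Nq ≤ 2 ^ n * P.K) (hθ : (1 / 2 : ℝ) ≤ P.θ₀)
    (hAmax : P.Amax ≤ 2 ^ n * P.Ω) (hA1 : ∀ j, 1 ≤ P.A j) {r : ℕ} (hr0 : 0 < r) (hrn : r < n)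
    (hnum : ((r ! : ℕ) : ℝ) ^ 3 * (n : ℝ) ^ r * (((n + 1)! : ℕ) : ℝ) * 2 ^ (r - 1) *
          (((2 : ℝ) ^ (n + 23))⁻¹ + 2 ^ n / (24 * Cb ^ n)) ^ r * (264 * Cb ^ n + 2 ^ (2 * n + 26)) *
          (14 * n + 3) ≤
        (256 : ℝ) ^ (n - r) * (16 * ((n : ℝ) + 1) / ((n : ℝ) + 2) ^ 4) ^ r * 2 ^ (n + 22) *
          (((n - r)! : ℕ) : ℝ)) :
    ((r ! : ℕ) : ℝ) ^ 2 * (n : ℝ) ^ r *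
        (((((n + 1)! * 2 ^ n * P.D₀ : ℕ) : ℝ) * ((P.Nq : ℝ) * P.L / 2 ^ P.Sdepth + P.Amax) ^ r /
          ((Nat.choose (P.S₀N + (r - 0)) (r - 0) * (2 * P.Xfin + 1) *
            ((0 + (n - r))! * 2 ^ (n - r) * P.D₀ ^ 0) : ℕ) : ℝ))) * (14 * n + 3) ≤
      (256 : ℝ) ^ (n - r) * P.Ω := by
  obtain ⟨hσL, hchoose, hxfK, hΛL, hLKΩ⟩ := P.clauseC_facts hKNq hNqK hθ hAmax hA1
  set lam : ℝ := ((2 : ℝ) ^ (n + 23))⁻¹ + 2 ^ n / (24 * Cb ^ n) with hlam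
  set cL : ℝ := 264 * Cb ^ n + 2 ^ (2 * n + 26) with hcL
  set σ : ℝ := 16 * ((n : ℝ) + 1) / ((n : ℝ) + 2) ^ 4 with hσ
  set s : ℝ := (P.S₀N : ℝ) + 1 with hsdef
  set Λ : ℝ := (P.Nq : ℝ) * P.L / 2 ^ P.Sdepth + P.Amax with hΛdef
  set L : ℝ := (P.L : ℝ) with hLdef
  have hL : 0 < L := by rw [hLdef]; linarith [P.one_le_L]
  have hΩ := P.Ω_pos
  have hKpos := P.K_pos
  have hX1 : (1 : ℝ) ≤ P.X := by exact_mod_cast P.one_le_X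
  have hΛ0 : 0 ≤ Λ := by have := P.hAmax1; positivity
  have hCb : (0 : ℝ) < Cb ^ n := by have := sixtyfour_le_Cb; positivity
  have hσ0 : 0 < σ := by positivity
  have hcL0 : 0 < cL := by positivity
  have hΛr : Λ ^ r ≤ (lam * L) ^ r := pow_le_pow_left₀ hΛ0 hΛL r
  have hch := hchoose r
  have hden := P.den_pos r 0
  simp only [Nat.sub_zero, zero_add, pow_zero, mul_one] at hden ⊢
  rw [mul_div_assoc', div_mul_eq_mul_div, div_le_iff₀ hden]
  push_cast
  have h2n : (2 : ℝ) ^ n = 2 ^ (r - 1) * 2 * 2 ^ (n - r) := by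
    rw [← pow_succ, Nat.sub_add_cancel hr0, ← pow_add, Nat.add_sub_cancel' hrn.le]
  have hrfac : (0 : ℝ) < ((r ! : ℕ) : ℝ) := by exact_mod_cast Nat.factorial_pos _
  have hD₀ : (P.D₀ : ℝ) ≤ P.X * L / 2 := by
    have h := P.D₀_le
    have hL24 : (2 : ℝ) ^ (n + 24) ≤ P.L := by exact_mod_cast P.two_pow_le_L
    have h24 : (2 : ℝ) ^ 24 ≤ 2 ^ (n + 24) := pow_le_pow_right₀ (by norm_num) (by omega)
    rw [hLdef]; nlinarith
  set S : ℝ := P.X * L ^ (r + 1) * 2 ^ (n - r) with hS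
  have hS0 : 0 < S := by positivity
  -- (1)
  have step1 : ((r ! : ℕ) : ℝ) ^ 2 * (n : ℝ) ^ r * ((((n + 1)! : ℕ) : ℝ) * 2 ^ n * (P.D₀ : ℝ) * Λ ^ r) *
        (14 * n + 3) * (((r ! : ℕ) : ℝ) * cL) ≤
      (((r ! : ℕ) : ℝ) ^ 3 * (n : ℝ) ^ r * (((n + 1)! : ℕ) : ℝ) * 2 ^ (r - 1) * lam ^ r * cL *
          (14 * n + 3)) * S := by
    calc ((r ! : ℕ) : ℝ) ^ 2 * (n : ℝ) ^ r * ((((n + 1)! : ℕ) : ℝ) * 2 ^ n * (P.D₀ : ℝ) * Λ ^ r) *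
          (14 * n + 3) * (((r ! : ℕ) : ℝ) * cL)
        ≤ ((r ! : ℕ) : ℝ) ^ 2 * (n : ℝ) ^ r * ((((n + 1)! : ℕ) : ℝ) * 2 ^ n * (P.X * L / 2) * (lam * L) ^ r) *
          (14 * n + 3) * (((r ! : ℕ) : ℝ) * cL) := by gcongr
      _ = (((r ! : ℕ) : ℝ) ^ 3 * (n : ℝ) ^ r * (((n + 1)! : ℕ) : ℝ) * 2 ^ (r - 1) * lam ^ r * cL *
          (14 * n + 3)) * S := by rw [hS, h2n, mul_pow]; ring
  -- (2)
  have step2 : (((r ! : ℕ) : ℝ) ^ 3 * (n : ℝ) ^ r * (((n + 1)! : ℕ) : ℝ) * 2 ^ (r - 1) * lam ^ r * cL *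
          (14 * n + 3)) * S ≤
      ((256 : ℝ) ^ (n - r) * σ ^ r * 2 ^ (n + 22) * (((n - r)! : ℕ) : ℝ)) * S :=
    mul_le_mul_of_nonneg_right hnum hS0.le
  -- (3)
  have hσpow : (σ * L) ^ r ≤ ((r ! : ℕ) : ℝ) * ((Nat.choose (P.S₀N + r) r : ℕ) : ℝ) :=
    (pow_le_pow_left₀ (by positivity) hσL _).trans hch
  have step3 : ((256 : ℝ) ^ (n - r) * σ ^ r * 2 ^ (n + 22) * (((n - r)! : ℕ) : ℝ)) * S ≤
      (256 : ℝ) ^ (n - r) * P.Ω * (((Nat.choose (P.S₀N + r) r : ℕ) : ℝ) * (2 * (P.Xfin : ℝ) + 1) *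
        ((((n - r)! : ℕ) : ℝ) * 2 ^ (n - r))) * (((r ! : ℕ) : ℝ) * cL) := by
    calc ((256 : ℝ) ^ (n - r) * σ ^ r * 2 ^ (n + 22) * (((n - r)! : ℕ) : ℝ)) * S
        = (256 : ℝ) ^ (n - r) * (σ * L) ^ r * L * (2 ^ (n + 22) * P.X) *
            ((((n - r)! : ℕ) : ℝ) * 2 ^ (n - r)) := by rw [hS, mul_pow, pow_succ]; ring
      _ ≤ (256 : ℝ) ^ (n - r) * (((r ! : ℕ) : ℝ) * ((Nat.choose (P.S₀N + r) r : ℕ) : ℝ)) *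
            (cL * P.K * P.Ω) * (2 ^ (n + 22) * P.X) * ((((n - r)! : ℕ) : ℝ) * 2 ^ (n - r)) := by
          gcongr
      _ = (256 : ℝ) ^ (n - r) * P.Ω * (((Nat.choose (P.S₀N + r) r : ℕ) : ℝ) *
            (2 ^ (n + 22) * P.K * P.X) * ((((n - r)! : ℕ) : ℝ) * 2 ^ (n - r))) * (((r ! : ℕ) : ℝ) * cL) := by
          ring
      _ ≤ (256 : ℝ) ^ (n - r) * P.Ω * (((Nat.choose (P.S₀N + r) r : ℕ) : ℝ) *
            (2 * (P.Xfin : ℝ) + 1) * ((((n - r)! : ℕ) : ℝ) * 2 ^ (n - r))) * (((r ! : ℕ) : ℝ) * cL) := by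
          gcongr
  exact le_of_mul_le_mul_right (step1.trans (step2.trans step3)) (by positivity)

end PadicG3Par

end Summit.ABC.StewartYu

end
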